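import Summits.QuantumFields.YangMills.Theorems.BalabanLadderUVSeamRecResponseVarianceFloor
import Summits.QuantumFields.YangMills.Theorems.BalabanLadderNTMarkovMirrorDefectTypical
import Summits.QuantumFields.YangMills.Theorems.BalabanLadderUVSeamRecResponseMomentsDefs
import HarnessLib

/-!
# Crux `UVSeamRec` (stmt-QuantumFields-20043), v5(α) stub `stub_responseMomentsOdd6`: (RM) forces a TWO-POINT CEILING across
# the collar (LEAD `ym-spine-20043-p1` g9; sequel of `…ResponseVarianceFloor`)

Helper file (`--supports stmt-QuantumFields-20043`).  Composition of three kernel-checked facts: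
* the response-variance FLOOR `Cov_T(H, F)² ≤ E_T[(kerE_Q(F) − p')²]·Var_T(H)` (`ResponseVariance.sq_torusCov_le_torusE_centred_sq_kerE_mul`,
  DLR with a spectator + Cauchy–Schwarz),
* the singleton clause of (RM) (`⟨exp((R⁴/C₁)|kerE − p|)⟩_T ≤ e^B`), instantiated as in `…ResponseMomentsTails`,
* `x²/2 ≤ eˣ` on the torus (`MarkovMirror.torusE_sq_le_of_expMoment`: `E_T[Φ²] ≤ 2e^B/λ²`),
giving **`sq_torusCov_plane_le_of_responseMoments`**: under (RM) at unit `a` [`p`, `C₁ > 0`, `B`, `β₁`, `ℓ₁`], for `β ≥ β₁`,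
`1 ≤ R`, `R·a β ≤ ℓ₁`, `4R+8 ≤ L`, `q.1 < q.2`, a site `x` whose cube `(x − (R+1), 2R+3)` sits in the coordinate window of the odd
torus, and ANY plaquette `(q', y)` one layer off the cube (inside the window):

  `Cov_T(P_{q'}(y), P_q(x))² ≤ (2 e^B C₁² / R⁸) · Var_T(P_{q'}(y))`.

So the registered measure-side stub implies a plain, kernel-free TWO-POINT CEILING `|Cov_T(P(y), P(x))| ≤ √2 e^{B/2} C₁ σ(P) / R⁴` for
plaquettes at sup-distance `≥ R + 2` — the scaling dimension of `tr F²` read as a decay rate `dist⁻⁴` (the true perturbative decay is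
`dist⁻⁸`; the NT side's two-point FLOORS `Cov ≳ c₂Γ/n⁸` (`FC2`, `TwoPointPinned`) sit below it: compatible orders, no tension), and a
quantity a Monte-Carlo desk measures WITHOUT any inner kernel sampling (LEAD g9 kit jobs j285653–j285658: plaquette two-point tables
`|Δ|∞ ≤ 8` on 24⁴ at β_std ∈ {2.3, 2.5, 2.7, 3, 4}).  `twoPointCeiling_of_responseMomentsOdd6SU2` is the same read off the NAMED binder
`ResponseMomentsOdd6SU2` (= the registered stub's body, `responseMomentsOdd6SU2_iff`).

HONEST FRAMING: a necessary condition of ONE OPEN binder of a CONDITIONAL chain; nothing of E0′, NT or the gap; not Clay.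
-/

set_option autoImplicit false

noncomputable section

open MeasureTheory Filter Topology
open Literature.MathematicalPhysics.QuantumFieldTheory Literature.MathematicalPhysics.QuantumLattice
open Literature.Probability.LatticeModels
open Summit.QuantumFields.YangMills.Cruxes.OSLegsFromFemtoAndGap.DlrCollarTransfer
open Summit.QuantumFields.YangMills.Cruxes.NT.MarkovMirror (torusE_sq_le_of_expMoment)
open Summit.QuantumFields.YangMills.Cruxes.UVSeamRec.TemperedResponse (continuous_kerE_plane)

namespace Summit.QuantumFields.YangMills.Cruxes.UVSeamRec.ResponseVariance

section General

variable (G : Type) [Group G] [TopologicalSpace G] [IsTopologicalGroup G] [CompactSpace G]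
  [MeasurableSpace G] [BorelSpace G] (r : LatticeRep G) (a : ℝ → ℝ)

/-- **Two-point ceiling across the collar from a singleton exponential response moment.**  If at `(β, L, R)` the cube
`(x − (R+1), 2R+3)` sits in the coordinate window of the odd torus of side `2L+1` and
`⟨exp((R⁴/C₁)|kerE(P_q(x)) − p'|)⟩_T ≤ e^B` (`C₁ > 0`), then for every plaquette `(q', y)` one layer off the cube inside the window
`Cov_T(P_{q'}(y), P_q(x))² ≤ (2e^B C₁²/R⁸)·Var_T(P_{q'}(y))`. [folklore] -/
theorem sq_torusCov_plane_le_of_expMoment {β : ℝ} {L R : ℕ} (hR : 1 ≤ R) (q q' : Fin 4 × Fin 4) (x y : Fin 4 → ℤ)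
    (hx : ∀ j, -(L : ℤ) + R + 2 ≤ x j ∧ x j + (R : ℤ) + 4 ≤ (L : ℤ) + 1)
    (hy : ∃ j : Fin 4, y j + 2 ≤ x j - ((R : ℤ) + 1) ∨ x j + (R : ℤ) + 2 ≤ y j)
    (hywin : ∀ j, -(L : ℤ) + 1 ≤ y j ∧ y j + 1 ≤ (L : ℤ) - 1) {C₁ B p' : ℝ} (hC₁ : 0 < C₁)
    (h : torusE G r β L (fun U => Real.exp ((R : ℝ) ^ 4 / C₁ *
        |kerE G r β (fun k => x k - ((R : ℤ) + 1)) (2 * R + 3) U (plane G r q x) - p'|)) ≤ Real.exp B) :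
    (torusE G r β L (fun U => plane G r q' y U * plane G r q x U) -
        torusE G r β L (plane G r q' y) * torusE G r β L (plane G r q x)) ^ 2 ≤
      (2 * Real.exp B * C₁ ^ 2 / (R : ℝ) ^ 8) *
        (torusE G r β L (fun U => plane G r q' y U * plane G r q' y U) -
          torusE G r β L (plane G r q' y) * torusE G r β L (plane G r q' y)) := by
  obtain ⟨C, hC⟩ := exists_abs_plane_le (G := G) r
  set c : Fin 4 → ℤ := fun k => x k - ((R : ℤ) + 1) with hc_def
  have hc : ∀ j, -(L : ℤ) + 1 ≤ c j ∧ c j + ((2 * R + 3 : ℕ) : ℤ) + 2 ≤ (L : ℤ) + 1 := by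
    intro j; have := hx j; simp only [hc_def]; push_cast; constructor <;> linarith [this.1, this.2]
  have hywin' : ∀ e ∈ (originPlaquetteSupport q'.1 q'.2).image (fun e => (e.1 - -y, e.2)), ∀ j,
      -(L : ℤ) + 1 ≤ e.1 j ∧ e.1 j ≤ (L : ℤ) - 1 := by
    intro e he j
    have h' := near_of_mem_supp_plane he j
    constructor <;> linarith [h'.1, h'.2, (hywin j).1, (hywin j).2]
  -- the floor in mean-square form, centred at `p'`
  have hfloor := sq_torusCov_le_torusE_centred_sq_kerE_mul G r β c (2 * R + 3) L hc
    (continuous_plane r q x) (continuous_plane r q' y) (hC q x) (hC q' y)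
    (isCylinder_plane r q x) (isCylinder_plane r q' y) (supp_plane_window R q x)
    (supp_plane_off_cube q' hy) hywin' p'
  -- the mean-square ceiling from the exponential moment
  have hk : Continuous fun U => kerE G r β c (2 * R + 3) U (plane G r q x) - p' :=
    (continuous_kerE_plane r β c (2 * R + 3) q x).sub continuous_const
  have hlam : 0 < (R : ℝ) ^ 4 / C₁ := by positivity
  have hsq := torusE_sq_le_of_expMoment G r β L hk hlam h
  have hsq' : torusE G r β L (fun η => (kerE G r β c (2 * R + 3) η (plane G r q x) - p') *
      (kerE G r β c (2 * R + 3) η (plane G r q x) - p')) ≤ 2 * Real.exp B * C₁ ^ 2 / (R : ℝ) ^ 8 := by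
    have e1 : (fun η => (kerE G r β c (2 * R + 3) η (plane G r q x) - p') *
        (kerE G r β c (2 * R + 3) η (plane G r q x) - p')) =
        fun η => (kerE G r β c (2 * R + 3) η (plane G r q x) - p') ^ 2 := funext fun _ => (sq _).symm
    have hRpos : (0 : ℝ) < (R : ℝ) := by exact_mod_cast hR
    have e2 : 2 * Real.exp B / ((R : ℝ) ^ 4 / C₁) ^ 2 = 2 * Real.exp B * C₁ ^ 2 / (R : ℝ) ^ 8 := by
      field_simp
    rw [e1, ← e2]
    exact hsq
  have hVH : 0 ≤ torusE G r β L (fun U => plane G r q' y U * plane G r q' y U) -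
      torusE G r β L (plane G r q' y) * torusE G r β L (plane G r q' y) := by
    have := torusE_sq_le_torusE_mul_self G r β L (continuous_plane r q' y)
    nlinarith
  exact hfloor.trans (mul_le_mul_of_nonneg_right hsq' hVH)

/-- **(RM) forces a two-point ceiling across the collar.**  Under (RM) at unit `a` [`p`, `C₁ > 0`, `B`, `β₁`, `ℓ₁`] (the `hRM` of
`…CeilingsResponseMoments` / `…ResponseMomentsTails` VERBATIM): for `β ≥ β₁`, `1 ≤ R`, `R·a β ≤ ℓ₁`, `4R+8 ≤ L`, `q.1 < q.2`, a
site `x` with its cube in the window and any plaquette `(q', y)` one layer off the cube inside the window,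
`Cov_T(P_{q'}(y), P_q(x))² ≤ (2e^B C₁²/R⁸)·Var_T(P_{q'}(y))`. [folklore] -/
theorem sq_torusCov_plane_le_of_responseMoments {C₁ B β₁ ℓ₁ : ℝ} {p : Fin 4 × Fin 4 → ℝ → ℝ} (hC₁ : 0 < C₁)
    (hRM : ∀ β : ℝ, β₁ ≤ β → ∀ (L n : ℕ) (q : Fin n → Fin 4 × Fin 4) (x : Fin n → (Fin 4 → ℤ)) (R : ℕ),
      (∀ i, (q i).1 < (q i).2) → 1 ≤ R → (R : ℝ) * a β ≤ ℓ₁ → 4 * R + 8 ≤ L →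
      (∀ i j : Fin n, i ≠ j → ∃ k : Fin 4,
        (2 * (R : ℤ) + 4) ≤ |((((x i k - x j k : ℤ) : ZMod (2 * L + 1))).valMinAbs : ℤ)|) →
      ∀ T : Finset (Fin n),
        torusE G r β L (fun U => Real.exp (∑ i ∈ T, (R : ℝ) ^ 4 / C₁ *
          |kerE G r β (fun k => x i k - (R + 1)) (2 * R + 3) U (plane G r (q i) (x i)) - p (q i) β|)) ≤
          Real.exp (B * T.card))
    {β : ℝ} (hβ : β₁ ≤ β) {L R : ℕ} (q q' : Fin 4 × Fin 4) (x y : Fin 4 → ℤ) (hq : q.1 < q.2) (hR : 1 ≤ R)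
    (hRa : (R : ℝ) * a β ≤ ℓ₁) (hRL : 4 * R + 8 ≤ L)
    (hx : ∀ j, -(L : ℤ) + R + 2 ≤ x j ∧ x j + (R : ℤ) + 4 ≤ (L : ℤ) + 1)
    (hy : ∃ j : Fin 4, y j + 2 ≤ x j - ((R : ℤ) + 1) ∨ x j + (R : ℤ) + 2 ≤ y j)
    (hywin : ∀ j, -(L : ℤ) + 1 ≤ y j ∧ y j + 1 ≤ (L : ℤ) - 1) :
    (torusE G r β L (fun U => plane G r q' y U * plane G r q x U) -
        torusE G r β L (plane G r q' y) * torusE G r β L (plane G r q x)) ^ 2 ≤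
      (2 * Real.exp B * C₁ ^ 2 / (R : ℝ) ^ 8) *
        (torusE G r β L (fun U => plane G r q' y U * plane G r q' y U) -
          torusE G r β L (plane G r q' y) * torusE G r β L (plane G r q' y)) := by
  have h1 := hRM β hβ L 1 (fun _ => q) (fun _ => x) R (fun _ => hq) hR hRa hRL
    (fun i j hij => absurd (Subsingleton.elim i j) hij) Finset.univ
  simp only [Finset.univ_unique, Finset.sum_singleton, Finset.card_singleton, Nat.cast_one, mul_one] at h1
  have h1' : torusE G r β L (fun U => Real.exp ((R : ℝ) ^ 4 / C₁ *
      |kerE G r β (fun k => x k - ((R : ℤ) + 1)) (2 * R + 3) U (plane G r q x) - p q β|)) ≤ Real.exp B := by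
    have e : (fun k => x k - ((R : ℤ) + 1)) = fun k => x k - (R + 1) := rfl
    rw [e]; exact h1
  exact sq_torusCov_plane_le_of_expMoment G r hR q q' x y hx hy hywin hC₁ h1'

end General

/-! ## Read off the named binder `ResponseMomentsOdd6SU2` (= the body of the registered stub) -/

/-- **The registered (RM) binder forces the two-point ceiling** for `SU(2)`, fundamental representation: there are the unit `a ≤ c·uRec`
eventually and constants `C₁ > 0`, `B`, `β₁`, `ℓ₁ > 0` of (RM) such that for `β ≥ β₁`, every odd torus and every admissible
`(R, q, x, q', y)` as above, `Cov_T(P_{q'}(y), P_q(x))² ≤ (2e^B C₁²/R⁸)·Var_T(P_{q'}(y))`. [folklore] -/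
theorem twoPointCeiling_of_responseMomentsOdd6SU2 (h : ResponseMomentsDefs.ResponseMomentsOdd6SU2) :
    letI : MeasurableSpace (Matrix.specialUnitaryGroup (Fin 2) ℂ) := borel _
    haveI : BorelSpace (Matrix.specialUnitaryGroup (Fin 2) ℂ) := ⟨rfl⟩
    ∃ (a : ℝ → ℝ) (c C₁ B β₁ ℓ₁ : ℝ), 0 < c ∧ (∀ᶠ β in atTop, a β ≤ c * Transport.uRec β) ∧ 0 < ℓ₁ ∧ 0 < C₁ ∧
      ∀ β : ℝ, β₁ ≤ β → ∀ (L R : ℕ) (q q' : Fin 4 × Fin 4) (x y : Fin 4 → ℤ), q.1 < q.2 → 1 ≤ R →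
        (R : ℝ) * a β ≤ ℓ₁ → 4 * R + 8 ≤ L →
        (∀ j, -(L : ℤ) + R + 2 ≤ x j ∧ x j + (R : ℤ) + 4 ≤ (L : ℤ) + 1) →
        (∃ j : Fin 4, y j + 2 ≤ x j - ((R : ℤ) + 1) ∨ x j + (R : ℤ) + 2 ≤ y j) →
        (∀ j, -(L : ℤ) + 1 ≤ y j ∧ y j + 1 ≤ (L : ℤ) - 1) →
        (torusE (Matrix.specialUnitaryGroup (Fin 2) ℂ) (fundamentalLatticeRep 2) β L
              (fun U => plane (Matrix.specialUnitaryGroup (Fin 2) ℂ) (fundamentalLatticeRep 2) q' y U *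
                plane (Matrix.specialUnitaryGroup (Fin 2) ℂ) (fundamentalLatticeRep 2) q x U) -
            torusE (Matrix.specialUnitaryGroup (Fin 2) ℂ) (fundamentalLatticeRep 2) β L
                (plane (Matrix.specialUnitaryGroup (Fin 2) ℂ) (fundamentalLatticeRep 2) q' y) *
              torusE (Matrix.specialUnitaryGroup (Fin 2) ℂ) (fundamentalLatticeRep 2) β L
                (plane (Matrix.specialUnitaryGroup (Fin 2) ℂ) (fundamentalLatticeRep 2) q x)) ^ 2 ≤
          (2 * Real.exp B * C₁ ^ 2 / (R : ℝ) ^ 8) *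
            (torusE (Matrix.specialUnitaryGroup (Fin 2) ℂ) (fundamentalLatticeRep 2) β L
                (fun U => plane (Matrix.specialUnitaryGroup (Fin 2) ℂ) (fundamentalLatticeRep 2) q' y U *
                  plane (Matrix.specialUnitaryGroup (Fin 2) ℂ) (fundamentalLatticeRep 2) q' y U) -
              torusE (Matrix.specialUnitaryGroup (Fin 2) ℂ) (fundamentalLatticeRep 2) β L
                  (plane (Matrix.specialUnitaryGroup (Fin 2) ℂ) (fundamentalLatticeRep 2) q' y) *
                torusE (Matrix.specialUnitaryGroup (Fin 2) ℂ) (fundamentalLatticeRep 2) β L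
                  (plane (Matrix.specialUnitaryGroup (Fin 2) ℂ) (fundamentalLatticeRep 2) q' y)) := by
  letI : MeasurableSpace (Matrix.specialUnitaryGroup (Fin 2) ℂ) := borel _
  haveI : BorelSpace (Matrix.specialUnitaryGroup (Fin 2) ℂ) := ⟨rfl⟩
  obtain ⟨a, c, C₁, B, β₁, ℓ₁, P₀, p, hc, ha, hℓ₁, hC₁, -, hRM⟩ := h
  exact ⟨a, c, C₁, B, β₁, ℓ₁, hc, ha, hℓ₁, hC₁, fun β hβ L R q q' x y hq hR hRa hRL hx hy hywin =>
    sq_torusCov_plane_le_of_responseMoments (Matrix.specialUnitaryGroup (Fin 2) ℂ) (fundamentalLatticeRep 2) a hC₁ hRM hβ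
      q q' x y hq hR hRa hRL hx hy hywin⟩

end Summit.QuantumFields.YangMills.Cruxes.UVSeamRec.ResponseVariance

end
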